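import Summits.AnomalousDissipation.AnomalousDissipation.Theorems.BaireTransferRobustLoudUpgradeLine
import Summits.AnomalousDissipation.AnomalousDissipation.Theorems.BaireTransferRobustLoudUpgradeStubSteadyPersist
import Summits.AnomalousDissipation.AnomalousDissipation.Theorems.BaireTransferRobustLoudUpgradeStubPeriodicWindow
import Summits.AnomalousDissipation.AnomalousDissipation.Theorems.BaireTransferRobustLoudUpgradePeriodicPersistOfHenry
import Literature.Analysis.FluidPDE.PeriodicNSOrbitPersistsProofs
import Literature.Analysis.FluidPDE.LongTimeAverageNonneg

/-!
# Stub `stub_realizeTempered` of the line `malkin-cone-group-orbits`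
# (crux stmt-AnomalousDissipation-1144, `BaireTransfer.RobustLoudUpgrade`, lead c16: lattice-tempered windows)

Realization with identified lattice data: a state `x` of the lattice state space `W ⊂ ℓ²(ℤ × ℤ³; ℂ³)`
whose unweighted family `x/Λ` solves the projected time-periodic Navier–Stokes lattice equation with
frequency `om > 0`, viscosity `ν > 0`, drift `m₀` and force `f_c` is the lattice data of a CLASSICAL
`om⁻¹`-periodic solution `u` of `NS_ν(f_c)` with mean `m₀`, and `𝓕(timeRoll om⁻¹ u − ∫u(0)) = x/Λ`.

The proof is the block "regularity of `c`" + "realization" of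
`Literature.Analysis.FluidPDE.TimePeriodicLattice.persists_main` with the reference state `x₀ = 0`:
the symbol lower bound `exists_symbol_lower_bound`, the parabolic bootstrap `moments_of_lattice_ineq`
and `rapidDecay_of_moments` make `x/Λ` rapidly decaying; `realize_nonlinear` synthesises
`u(t) = m₀ + Re F_{x/Λ}(om t, ·)`; finally `timeRoll om⁻¹ u = m₀ + Re F_{x/Λ}` (`timeRoll_comp_cons`), the
slice means of `Re F_{x/Λ}` vanish (`integral_timeSlice_synth_eq_zero`), and `𝓕(complexify ∘ Re F_{x/Λ}) = x/Λ`
(`realSynth_spec'`, `ext_cons`).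

References: G. Iooss, Arch. Rational Mech. Anal. 47 (1972) 301–329, §2; H. Kielhöfer, *Bifurcation Theory*,
2nd ed. (2012), §I.8; the template `Literature/Analysis/FluidPDE/PeriodicNSOrbitPersistsProofs.lean`
(`persists_main`).
-/

set_option linter.dupNamespace false

noncomputable section

open scoped BigOperators Topology ENNReal NNReal ComplexConjugate
open Filter Set Function TopologicalSpace MeasureTheory UnitAddTorus

namespace Summit.AnomalousDissipation.AnomalousDissipation.Theorems.RobustLoudUpgrade.Tempered

open Literature.Analysis.FunctionSpaces Literature.Analysis.FunctionSpaces.Torus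
open Literature.Analysis.FunctionSpaces.EuclideanSpace
open Literature.Analysis.FluidPDE Literature.Analysis.FluidPDE.ScalarFourier
open Literature.Analysis.FluidPDE.TimePeriodicLattice
open Summit.AnomalousDissipation.AnomalousDissipation.Theses.BaireTransfer
open Summit.AnomalousDissipation.AnomalousDissipation.Theorems.RobustLoudUpgrade

-- NOTATION START (verbatim the local notations of `Literature/Analysis/FluidPDE/PeriodicNSOrbitPersistsProofs.lean`)
/-- The flat unit torus `T³`. -/
local notation "𝕋³" => UnitAddTorus (Fin 3)
/-- Real velocity values. -/
local notation "ℝ³" => EuclideanSpace ℝ (Fin 3)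
/-- Complex coefficient values. -/
local notation "ℂ³" => EuclideanSpace ℂ (Fin 3)

/-- Local notation: the parabolic weight `Λ(n, k) = |n| + |k|²`. -/
local notation:max "Λ" m:max => (|((Prod.fst m : ℤ) : ℝ)| + freqNormSq (Prod.snd m))

/-- Local notation: the convective symbol on `ℤ × ℤ³` (as in `TimePeriodicNSLattice`). -/
local notation:max "𝐍[" a ", " b "]" m:max =>
  (WithLp.toLp 2 (fun p : Fin 3 => ∑ j : Fin 3, ∑' m' : ℤ × (Fin 3 → ℤ),
    a m' j * (dsym j (Prod.snd m - Prod.snd m') * b (m - m') p)) : EuclideanSpace ℂ (Fin 3))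

/-- Local notation: division by the weight. -/
local notation:max "𝐜" x:max => (fun mm : ℤ × (Fin 3 → ℤ) =>
  ((((|((Prod.fst mm : ℤ) : ℝ)| + freqNormSq (Prod.snd mm))⁻¹ : ℝ) : ℂ) • x mm))

/-- Local notation: multiplication by the weight. -/
local notation:max "𝐬" x:max => (fun mm : ℤ × (Fin 3 → ℤ) =>
  ((((|((Prod.fst mm : ℤ) : ℝ)| + freqNormSq (Prod.snd mm)) : ℝ) : ℂ) • x mm))

/-- Local notation: the family of coefficients of `x ∈ W ⊂ ℓ²`. -/
local notation:max "𝐰" x:max =>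
  (((x : lp (fun _ : ℤ × (Fin 3 → ℤ) => EuclideanSpace ℂ (Fin 3)) 2)) : ℤ × (Fin 3 → ℤ) → EuclideanSpace ℂ (Fin 3))

/-- Local notation: the symbol `σ_om(n,k) = 2πi om n + 4π²ν|k|² + 2πi m₀·k`. -/
local notation "σ[" om ", " ν ", " m₀ "]" => (fun mm : ℤ × (Fin 3 → ℤ) =>
  2 * Real.pi * Complex.I * ((om : ℝ) : ℂ) * ((Prod.fst mm : ℤ) : ℂ) +
    (((4 * Real.pi ^ 2 * ν * freqNormSq (Prod.snd mm) : ℝ)) : ℂ) +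
    2 * Real.pi * Complex.I * (∑ jj : Fin 3, ((m₀ jj : ℝ) : ℂ) * (((Prod.snd mm) jj : ℤ) : ℂ)))

/-- Local notation: the lattice family of the orbit `u` with period `τ`:
`û(n,k) = 𝓕(complexify ∘ (timeRoll τ u − ∫ u(0)))(n,k)`. -/
local notation:max "𝐨[" τ ", " u "]" => (fun mm : ℤ × (Fin 3 → ℤ) =>
  mFourierCoeff (EuclideanSpace.complexify ∘ fun y : UnitAddTorus (Fin 4) => Torus.timeRoll τ u y - ∫ x, u 0 x)
    (Fin.cons (Prod.fst mm) (Prod.snd mm) : Fin 4 → ℤ))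

/-- Local notation: the force family `y_F(n,k) = [k ≠ 0][n = 0] 𝓕(complexify ∘ F)(k)`. -/
local notation:max "𝐲" F:max => (fun mm : ℤ × (Fin 3 → ℤ) =>
  (ite (Prod.snd mm = 0) (0 : EuclideanSpace ℂ (Fin 3))
    (ite (Prod.fst mm = 0) (mFourierCoeff (EuclideanSpace.complexify ∘ F) (Prod.snd mm)) 0)))
-- NOTATION END

variable {W : Submodule ℝ (lp (fun _ : ℤ × (Fin 3 → ℤ) => EuclideanSpace ℂ (Fin 3)) 2)}

namespace stub_realizeTemperedAux

/-! ## Regularity of a lattice solution (pattern `persists_main`, "regularity of `c`", with `x₀ = 0`) -/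

-- adapted from `TimePeriodicLattice.persists_main` (PeriodicNSOrbitPersistsProofs.lean, block `hineq`)
/-- **The pointwise lattice inequality** `c₂ ‖x m‖ ≤ ‖y_F m‖ + ‖N(x/Λ,x/Λ) m‖ + ‖N(x₀/Λ,x/Λ) m‖ + ‖N(x/Λ,x₀/Λ) m‖`
off the zero spatial modes, from the projected lattice equation and the symbol lower bound
`c₂ Λ ≤ |σ|` (the two extra convective norms are nonnegative slack). [folklore] -/
theorem lattice_ineq (x x₀ : ℤ × (Fin 3 → ℤ) → ℂ³) (F : 𝕋³ → ℝ³) {om ν c₂ : ℝ} (m₀ : ℝ³)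
    (hcl : ∀ m : ℤ × (Fin 3 → ℤ), m.2 ≠ 0 → c₂ * Λ m ≤ ‖σ[om, ν, m₀] m‖)
    (heq : ∀ m : ℤ × (Fin 3 → ℤ), m.2 ≠ 0 →
      σ[om, ν, m₀] m • (𝐜 x) m + Torus.lerayCoeff m.2 (𝐍[𝐜 x, 𝐜 x] m) = (𝐲 F) m)
    (m : ℤ × (Fin 3 → ℤ)) (hm : m.2 ≠ 0) :
    c₂ * ‖x m‖ ≤ ‖(𝐲 F) m‖ + ‖𝐍[𝐜 x, 𝐜 x] m‖ + ‖𝐍[𝐜 x₀, 𝐜 x] m‖ + ‖𝐍[𝐜 x, 𝐜 x₀] m‖ := by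
  have he := heq m hm
  have hL : (Λ m) ≠ 0 := ne_of_gt (lt_of_lt_of_le one_pos (one_le_wt hm))
  have hxm : ‖x m‖ = Λ m * ‖(𝐜 x) m‖ := by
    have e1 : ‖(𝐜 x) m‖ = (Λ m)⁻¹ * ‖x m‖ := by
      change ‖((((Λ m)⁻¹ : ℝ)) : ℂ) • x m‖ = _
      rw [norm_smul, Complex.norm_real, Real.norm_of_nonneg (inv_nonneg.2 (wt_nonneg m))]
    rw [e1, ← mul_assoc, mul_inv_cancel₀ hL, one_mul]
  have hσ := hcl m hm
  have h1 : ‖σ[om, ν, m₀] m • (𝐜 x) m‖ ≤ ‖(𝐲 F) m‖ + ‖𝐍[𝐜 x, 𝐜 x] m‖ := by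
    rw [show σ[om, ν, m₀] m • (𝐜 x) m = (𝐲 F) m - Torus.lerayCoeff m.2 (𝐍[𝐜 x, 𝐜 x] m) by
      rw [← he]; exact (add_sub_cancel_right _ _).symm]
    exact (norm_sub_le _ _).trans (add_le_add le_rfl (SteadyLattice.norm_lerayCoeff_le _ _))
  rw [norm_smul] at h1
  have h0 : 0 ≤ ‖𝐍[𝐜 x₀, 𝐜 x] m‖ := norm_nonneg _
  have h0' : 0 ≤ ‖𝐍[𝐜 x, 𝐜 x₀] m‖ := norm_nonneg _
  calc c₂ * ‖x m‖ = (c₂ * Λ m) * ‖(𝐜 x) m‖ := by rw [hxm]; ring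
    _ ≤ ‖σ[om, ν, m₀] m‖ * ‖(𝐜 x) m‖ := mul_le_mul_of_nonneg_right hσ (norm_nonneg _)
    _ ≤ _ := by linarith

/-- **Regularity of a lattice solution**: if `x ∈ W` and `x/Λ` solves the projected lattice equation with
`om > 0`, `ν > 0`, drift `m₀` and a smooth force `F`, then the extension of `x/Λ` to `ℤ⁴` decays rapidly
(`exists_symbol_lower_bound` + `moments_of_lattice_ineq` with `x₀ = 0` + `rapidDecay_of_moments`). [folklore] -/
theorem rapidDecay_of_latticeEq
    (hW : ∀ x : lp (fun _ : ℤ × (Fin 3 → ℤ) => EuclideanSpace ℂ (Fin 3)) 2, x ∈ W ↔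
      (∀ n : ℤ, (x : ℤ × (Fin 3 → ℤ) → EuclideanSpace ℂ (Fin 3)) (n, 0) = 0) ∧
      (∀ mm : ℤ × (Fin 3 → ℤ), (∑ jj : Fin 3, ((mm.2 jj : ℤ) : ℂ) *
        ((x : ℤ × (Fin 3 → ℤ) → EuclideanSpace ℂ (Fin 3)) mm) jj) = 0) ∧
      (∀ mm : ℤ × (Fin 3 → ℤ), (x : ℤ × (Fin 3 → ℤ) → EuclideanSpace ℂ (Fin 3)) (-mm) =
        conjVec ((x : ℤ × (Fin 3 → ℤ) → EuclideanSpace ℂ (Fin 3)) mm)))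
    (x : W) {om ν : ℝ} (hom : 0 < om) (hν : 0 < ν) (m₀ : ℝ³) {F : 𝕋³ → ℝ³} (hF : IsSmooth F)
    (heq : ∀ m : ℤ × (Fin 3 → ℤ), m.2 ≠ 0 →
      σ[om, ν, m₀] m • (𝐜 (𝐰 x)) m + Torus.lerayCoeff m.2 (𝐍[𝐜 (𝐰 x), 𝐜 (𝐰 x)] m) = (𝐲 F) m) :
    RapidDecay (fun K : Fin 4 → ℤ => (𝐜 (𝐰 x)) ((K 0, Fin.tail K) : ℤ × (Fin 3 → ℤ))) := by
  obtain ⟨c₂, hc₂, hcl₂⟩ := exists_symbol_lower_bound hom hν m₀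
  -- the reference state `x₀ = 0`
  obtain ⟨x₀, hx₀⟩ : ∃ x₀ : ℤ × (Fin 3 → ℤ) → ℂ³, x₀ = 0 := ⟨0, rfl⟩
  have hx₀0 : ∀ n : ℤ, x₀ (n, 0) = 0 := fun n => by rw [hx₀]; rfl
  have hmomX₀ : ∀ N : ℕ, ∑' m : ℤ × (Fin 3 → ℤ), ENNReal.ofReal ((Λ m) ^ N) * ‖x₀ m‖ₑ ^ 2 ≠ ⊤ := by
    intro N
    simp only [hx₀, Pi.zero_apply, enorm_zero, ne_eq, OfNat.ofNat_ne_zero, not_false_eq_true, zero_pow, mul_zero,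
      tsum_zero, ENNReal.zero_ne_top]
  have hineq : ∀ m : ℤ × (Fin 3 → ℤ), m.2 ≠ 0 →
      c₂ * ‖(𝐰 x) m‖ ≤ ‖(𝐲 F) m‖ + ‖𝐍[𝐜 (𝐰 x), 𝐜 (𝐰 x)] m‖ + ‖𝐍[𝐜 x₀, 𝐜 (𝐰 x)] m‖ +
        ‖𝐍[𝐜 (𝐰 x), 𝐜 x₀] m‖ :=
    lattice_ineq (𝐰 x) x₀ F m₀ hcl₂ heq
  have hmomc := moments_of_lattice_ineq hc₂ (𝐰 x) x₀ (𝐲 F) (W_zero hW x) hx₀0 (l2_tsum_enorm_sq_ne_top _)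
    hmomX₀ (tsum_moment_yf_ne_top hF) hineq
  exact rapidDecay_of_moments (W_zero hW x) hmomc

/-! ## Identification of the lattice data of the synthesised orbit -/

variable {c : ℤ × (Fin 3 → ℤ) → ℂ³}

/-- **Slice means of the real synthesis vanish** when the zero spatial modes do:
`∫_{T³} Re F_{𝐄 c}(s, ·) = 0` (`integral_timeSlice_synth_eq_zero` pushed through the real part). [folklore] -/
theorem integral_realPart_synth_cons (hc0 : ∀ n : ℤ, c (n, 0) = 0)
    (hcr : RapidDecay (fun K : Fin 4 → ℤ => c ((K 0, Fin.tail K) : ℤ × (Fin 3 → ℤ)))) (s : UnitAddCircle) :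
    (∫ y : 𝕋³, EuclideanSpace.realPart
      (fourierSynth (fun K : Fin 4 → ℤ => c ((K 0, Fin.tail K) : ℤ × (Fin 3 → ℤ))) (Fin.cons s y))) = 0 := by
  have hint : Integrable (timeSlice (fourierSynth (fun K : Fin 4 → ℤ => c ((K 0, Fin.tail K) : ℤ × (Fin 3 → ℤ)))) s)
      volume :=
    ((hcr.isSmooth_fourierSynth).timeSlice s).integrable
  have h1 := (EuclideanSpace.realPart : ℂ³ →L[ℝ] ℝ³).integral_comp_comm hint
  have h2 := integral_timeSlice_synth_eq_zero hc0 hcr s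
  simp only [timeSlice_apply] at h1 h2
  rw [h1, h2, map_zero]

/-- **The mean of the synthesised orbit is the drift**: `∫_{T³} (m₀ + Re F_{𝐄 c}(s, ·)) = m₀`. [folklore] -/
theorem integral_const_add_realPart_synth_cons (hc0 : ∀ n : ℤ, c (n, 0) = 0)
    (hcr : RapidDecay (fun K : Fin 4 → ℤ => c ((K 0, Fin.tail K) : ℤ × (Fin 3 → ℤ)))) (s : UnitAddCircle)
    (m₀ : ℝ³) :
    (∫ y : 𝕋³, m₀ + EuclideanSpace.realPart
      (fourierSynth (fun K : Fin 4 → ℤ => c ((K 0, Fin.tail K) : ℤ × (Fin 3 → ℤ))) (Fin.cons s y))) = m₀ := by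
  have hint : Integrable (fun y : 𝕋³ => EuclideanSpace.realPart
      (fourierSynth (fun K : Fin 4 → ℤ => c ((K 0, Fin.tail K) : ℤ × (Fin 3 → ℤ))) (Fin.cons s y))) volume :=
    (EuclideanSpace.realPart : ℂ³ →L[ℝ] ℝ³).integrable_comp
      ((hcr.isSmooth_fourierSynth).timeSlice s).integrable
  rw [integral_add (integrable_const m₀) hint, integral_realPart_synth_cons hc0 hcr s, add_zero, integral_const,
    probReal_univ, one_smul]

/-- **The lattice data of the synthesised orbit**: for the `om⁻¹`-periodic field
`u(t) = m₀ + Re F_{𝐄 c}(om t, ·)` one has `timeRoll om⁻¹ u = m₀ + Re F_{𝐄 c}`, `∫ u(0) = m₀`, hence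
`𝓕(complexify ∘ (timeRoll om⁻¹ u − ∫u(0)))(n,k) = c (n,k)` (`realSynth_spec'`, `ext_cons`). [folklore] -/
theorem orbit_data_eq (hc0 : ∀ n : ℤ, c (n, 0) = 0) (hcs : ∀ m, c (-m) = conjVec (c m))
    (hcr : RapidDecay (fun K : Fin 4 → ℤ => c ((K 0, Fin.tail K) : ℤ × (Fin 3 → ℤ)))) {om : ℝ} (hom : om ≠ 0)
    (m₀ : ℝ³) :
    𝐨[om⁻¹, (fun t : ℝ => fun x : UnitAddTorus (Fin 3) => m₀ + EuclideanSpace.realPart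
      (fourierSynth (fun K : Fin 4 → ℤ => c ((K 0, Fin.tail K) : ℤ × (Fin 3 → ℤ)))
        (Fin.cons (((om * t : ℝ)) : UnitAddCircle) x)))] = c := by
  have hroll : timeRoll om⁻¹ (fun t : ℝ => fun x : UnitAddTorus (Fin 3) => m₀ + EuclideanSpace.realPart
      (fourierSynth (fun K : Fin 4 → ℤ => c ((K 0, Fin.tail K) : ℤ × (Fin 3 → ℤ)))
        (Fin.cons (((om * t : ℝ)) : UnitAddCircle) x))) =
      fun y : UnitAddTorus (Fin 4) => m₀ + EuclideanSpace.realPart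
        (fourierSynth (fun K : Fin 4 → ℤ => c ((K 0, Fin.tail K) : ℤ × (Fin 3 → ℤ))) y) :=
    timeRoll_comp_cons (fun y : UnitAddTorus (Fin 4) => m₀ + EuclideanSpace.realPart
      (fourierSynth (fun K : Fin 4 → ℤ => c ((K 0, Fin.tail K) : ℤ × (Fin 3 → ℤ))) y)) hom
  have hmean := integral_const_add_realPart_synth_cons hc0 hcr (((om * 0 : ℝ)) : UnitAddCircle) m₀
  obtain ⟨-, -, hVcoef⟩ := realSynth_spec' hcr (ext_neg_eq_conjVec (c := c) hcs)
  funext m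
  simp only [hroll, hmean, add_sub_cancel_left]
  rw [hVcoef (Fin.cons m.1 m.2)]
  exact ext_cons c m

end stub_realizeTemperedAux

open stub_realizeTemperedAux in
/-- **stub_realizeTempered** (realization with identified lattice data): a state `x ∈ W` whose unweighted family
`x/Λ` solves the projected lattice equation with frequency `om > 0`, viscosity `ν > 0`, drift `m₀` and force `f_c` is
the lattice data of a CLASSICAL `om⁻¹`-periodic solution `u` of `NS_ν(f_c)` with mean `m₀`:
`exists_symbol_lower_bound` + `moments_of_lattice_ineq` (with `x₀ = 0`) + `rapidDecay_of_moments` make `x/Λ` rapidly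
decaying, `realize_nonlinear` synthesises `u(t) = m₀ + Re F_{x/Λ}(om t, ·)`, and `timeRoll om⁻¹ u − m₀ = Re F_{x/Λ}`
(`timeRoll_comp_cons`, `integral_timeSlice_synth_eq_zero`, `realSynth_spec'`) identifies
`û = x/Λ` (pattern `persists_main`, lines "regularity of `c`" to "realization"). [folklore] -/
theorem stub_realizeTempered
    (hW : ∀ x : lp (fun _ : ℤ × (Fin 3 → ℤ) => EuclideanSpace ℂ (Fin 3)) 2, x ∈ W ↔
      (∀ n : ℤ, (x : ℤ × (Fin 3 → ℤ) → EuclideanSpace ℂ (Fin 3)) (n, 0) = 0) ∧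
      (∀ mm : ℤ × (Fin 3 → ℤ), (∑ jj : Fin 3, ((mm.2 jj : ℤ) : ℂ) *
        ((x : ℤ × (Fin 3 → ℤ) → EuclideanSpace ℂ (Fin 3)) mm) jj) = 0) ∧
      (∀ mm : ℤ × (Fin 3 → ℤ), (x : ℤ × (Fin 3 → ℤ) → EuclideanSpace ℂ (Fin 3)) (-mm) =
        conjVec ((x : ℤ × (Fin 3 → ℤ) → EuclideanSpace ℂ (Fin 3)) mm)))
    {S : Finset (Fin 3 → ℤ)} (c : Coeff S) (x : W) {om ν : ℝ} (hom : 0 < om) (hν : 0 < ν) (m₀ : ℝ³)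
    (heq : ∀ m : ℤ × (Fin 3 → ℤ), m.2 ≠ 0 →
      σ[om, ν, m₀] m • (𝐜 (𝐰 x)) m + Torus.lerayCoeff m.2 (𝐍[𝐜 (𝐰 x), 𝐜 (𝐰 x)] m) = (𝐲 (force S c)) m) :
    ∃ (u : ℝ → 𝕋³ → ℝ³) (p : ℝ → 𝕋³ → ℝ),
      IsClassicalNSSolutionOn Set.univ ν (fun _ => force S c) u p ∧ Function.Periodic u om⁻¹ ∧
      (∫ y, u 0 y) = m₀ ∧ 𝐨[om⁻¹, u] = 𝐜 (𝐰 x) := by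
  -- the unscaled family `x/Λ`
  have hc0 : ∀ n : ℤ, (𝐜 (𝐰 x)) (n, 0) = 0 := cw_zero_mode (W_zero hW x)
  have hct : ∀ mm : ℤ × (Fin 3 → ℤ), (∑ jj : Fin 3, ((mm.2 jj : ℤ) : ℂ) * ((𝐜 (𝐰 x)) mm) jj) = 0 :=
    cw_transversal (W_trans hW x)
  have hcs : ∀ mm : ℤ × (Fin 3 → ℤ), (𝐜 (𝐰 x)) (-mm) = conjVec ((𝐜 (𝐰 x)) mm) := cw_neg (W_conj hW x)
  have hceq : ∀ m : ℤ × (Fin 3 → ℤ), m.2 ≠ 0 →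
      (2 * Real.pi * Complex.I * (om : ℂ) * (m.1 : ℂ) + ((4 * Real.pi ^ 2 * ν * freqNormSq m.2 : ℝ) : ℂ) +
          2 * Real.pi * Complex.I * (∑ jj : Fin 3, (((m₀ jj : ℝ)) : ℂ) * ((m.2 jj : ℤ) : ℂ))) • (𝐜 (𝐰 x)) m +
        Torus.lerayCoeff m.2 (𝐍[𝐜 (𝐰 x), 𝐜 (𝐰 x)] m) =
        if m.1 = 0 then mFourierCoeff (complexify ∘ force S c) m.2 else 0 := fun m hm =>
    (heq m hm).trans (yf_of_snd_ne_zero (force S c) hm)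
  -- regularity of `x/Λ`
  have hcr : RapidDecay (fun K : Fin 4 → ℤ => (𝐜 (𝐰 x)) ((K 0, Fin.tail K) : ℤ × (Fin 3 → ℤ))) :=
    rapidDecay_of_latticeEq hW x hom hν m₀ (SteadyPersist.isSmooth_force' c) heq
  -- realization
  obtain ⟨p', hsol', hper'⟩ := realize_nonlinear (ν := ν) (m₀ := m₀) (F := force S c) (c := 𝐜 (𝐰 x)) hom
    (SteadyPersist.isSmooth_force' c) (SteadyPersist.isDivFree_force' c) (SteadyPersist.hasZeroMean_force' c)
    hc0 hct hcs hcr hceq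
  -- identification of the mean and of the lattice data
  exact ⟨_, p', hsol', hper', integral_const_add_realPart_synth_cons (c := 𝐜 (𝐰 x)) hc0 hcr _ m₀,
    orbit_data_eq (c := 𝐜 (𝐰 x)) hc0 hcs hcr hom.ne' m₀⟩

end Summit.AnomalousDissipation.AnomalousDissipation.Theorems.RobustLoudUpgrade.Tempered

end
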